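import Literature.NumberTheory.Automorphic.CongruenceSubgroupPropertySL2UnitOrders
import HarnessLib

/-!
# Serre's congruence subgroup property for `SL₂(𝓞_F)` — proofs, IV: Mennicke symbols
# (Bass–Milnor–Serre, Ch. I §2 and Thm. 3.6, steps (i)–(ii): every symbol has order dividing `2`)

Topic `Literature/NumberTheory/Automorphic`; namespace `Literature.NumberTheory.Automorphic`
(sub-namespace `SerreSL2`).  Everything here is PROVED; the only definition is the structure
`SerreSL2.MennickeSymbol` (BMS Def. 2.5).

**Bass–Milnor–Serre 1967, Ch. I.**  For a commutative ring `A` and an ideal `𝔮`,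
`W_𝔮 = {(a, b) : a ≡ 1 (mod 𝔮), b ∈ 𝔮, aA + bA = A}`; a *Mennicke symbol* on `W_𝔮` with values in a
group `C` is a map `[ ] : W_𝔮 → C` with **MS1** `[0 over 1] = 1`, `[b + ta over a] = [b over a]`
(`t ∈ 𝔮`), `[b over a + tb] = [b over a]` (`t ∈ A`) and **MS2** `[b₁b₂ over a] = [b₁ over a][b₂ over a]`
(Def. 2.5).  We record it as a total function `sym : A → A → C` (`sym a b = [b over a]`) whose axioms
are only required on `W_𝔮`, and prove, for `𝔮 = (q)` principal where needed:

* `MennickeSymbol.sym_eq_one_of_eq_unit_sub`, `sym_eq_one_of_eq_unit_add` — **Lemma 2.2 (b) /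
  2.7 (a)**: `[b over a] = 1` if `a ≡ u (mod b)` or `b ≡ u (mod a)` with `u` a unit;
* `MennickeSymbol.sym_mul_q_eq_of_sub_mem` — **Lemma 2.7 (c)**: for `a ≡ 1 (mod q)`, `b ↦ [bq over a]`
  only depends on `b mod a`; `sym_mul_q_mul` — **Lemma 2.9 (a)**: it is multiplicative;
  `sym_mul_q_pow`, `sym_mul_q_pow_eq_one` — hence `[bq over a]ⁿ = 1` when `bⁿ ≡ 1 (mod a)`;
* `MennickeSymbol.sym_sq_eq_one` — **Thm. 3.6, steps (i)–(ii), for `A = 𝓞_K`, `K` with a real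
  place (`m = 2`)**: every symbol value has order dividing `2`.  BMS: "Given `(a, b) ∈ W_𝔮` we can
  find `(a₁, b₁) ∼ (a, b)` as in Theorem 3.2.  This implies that `U(A/a₁A)` has no elements of order
  `p^{n+1}` … so `[b over a]` lies in a homomorphic image of `U(A/a₁A)`.  Consequently `C` has no
  elements of order `p^{n+1}`."  Here Thm. 3.2 is the tree's
  `SerreSL2.exists_add_mul_forall_not_dvd_orderOf` (file `…UnitOrders`), and cyclicity of `C`
  (step (i), Lemma 2.4) is not needed: we bound the order of each symbol value directly.

Step (iii) of Thm. 3.6 (every symbol is a square, via Thm. 3.5 Case 1 and reciprocity), giving the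
triviality of all Mennicke symbols on `W_𝔮` when `A` has a real place, is the next file.

## References

* [BassMilnorSerre1967] H. Bass, J. Milnor, J.-P. Serre, Publ. Math. IHES 33 (1967), Ch. I,
  Def. 2.5, Lemmas 2.2, 2.7, 2.9, Thms. 3.2, 3.6.
-/

open NumberField

namespace Literature.NumberTheory.Automorphic

namespace SerreSL2

/-- **A Mennicke symbol on `W_𝔮`** (Bass–Milnor–Serre, Ch. I, Def. 2.5), as a total function
`sym a b = [b over a]` on `A × A` with values in a group `C`, subject to MS1 and MS2 on
`W_𝔮 = {(a, b) : a - 1 ∈ 𝔮, b ∈ 𝔮, IsCoprime a b}` (values off `W_𝔮` are irrelevant).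
[cite: BassMilnorSerre1967, Ch. I Def. 2.5] -/
structure MennickeSymbol {A : Type*} [CommRing A] (𝔮 : Ideal A) (C : Type*) [Group C] where
  /-- `sym a b = [b over a]`. -/
  sym : A → A → C
  /-- MS1: `[0 over 1] = 1`. -/
  sym_one_zero : sym 1 0 = 1
  /-- MS1: `[b + ta over a] = [b over a]` for `t ∈ 𝔮`. -/
  ms1_right : ∀ ⦃a b t : A⦄, a - 1 ∈ 𝔮 → b ∈ 𝔮 → IsCoprime a b → t ∈ 𝔮 →
    sym a (b + t * a) = sym a b
  /-- MS1: `[b over a + tb] = [b over a]` for all `t ∈ A`. -/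
  ms1_left : ∀ ⦃a b : A⦄ (t : A), a - 1 ∈ 𝔮 → b ∈ 𝔮 → IsCoprime a b →
    sym (a + t * b) b = sym a b
  /-- MS2: `[b₁ b₂ over a] = [b₁ over a] [b₂ over a]`. -/
  ms2 : ∀ ⦃a b₁ b₂ : A⦄, a - 1 ∈ 𝔮 → b₁ ∈ 𝔮 → b₂ ∈ 𝔮 → IsCoprime a b₁ → IsCoprime a b₂ →
    sym a (b₁ * b₂) = sym a b₁ * sym a b₂

namespace MennickeSymbol

section CommRing

variable {A : Type*} [CommRing A] {𝔮 : Ideal A} {C : Type*} [Group C] (M : MennickeSymbol 𝔮 C)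

omit [Group C] in
/-- A unit is coprime to everything. [folklore] -/
theorem isCoprime_unit_left (u : Aˣ) (b : A) : IsCoprime (u : A) b :=
  ⟨(u⁻¹ : Aˣ), 0, by simp⟩

/-- `[b over 1] = 1` for `b ∈ 𝔮` (`(1, b) ∼ (1, b - b·1) = (1, 0)`).
[cite: BassMilnorSerre1967, Ch. I Lemma 2.2] -/
theorem sym_one_left {b : A} (hb : b ∈ 𝔮) : M.sym 1 b = 1 := by
  have h := M.ms1_right (a := 1) (b := b) (t := -b) (by simp) hb isCoprime_one_left (𝔮.neg_mem hb)
  rw [mul_one, add_neg_cancel, M.sym_one_zero] at h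
  exact h.symm

/-- **BMS Lemma 2.2 (b) / 2.7 (a), first case**: if `a = u - tb` with `u` a unit (`a ≡` unit
`mod bA`), then `[b over a] = 1`: `(a, b) ∼ (u, b) ∼ (u, 1 - u) ∼ (1, 1 - u) ∼ (1, 0)`.
[cite: BassMilnorSerre1967, Ch. I Lemma 2.2 (b)] -/
theorem sym_eq_one_of_eq_unit_sub {a b : A} (t : A) (u : Aˣ) (ha : a - 1 ∈ 𝔮) (hb : b ∈ 𝔮)
    (hab : IsCoprime a b) (h : a = u - t * b) : M.sym a b = 1 := by
  have hu1 : (u : A) - 1 ∈ 𝔮 := by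
    have : (u : A) - 1 = (a - 1) + t * b := by rw [h]; ring
    rw [this]; exact 𝔮.add_mem ha (𝔮.mul_mem_left _ hb)
  have hub : IsCoprime (u : A) b := isCoprime_unit_left u b
  -- `(a, b) ∼ (u, b)`
  have h1 : M.sym a b = M.sym u b := by
    rw [← M.ms1_left t ha hb hab, h]; ring_nf
  -- `(u, b) ∼ (u, 1 - u)` with `t' = (1 - u - b) u⁻¹ ∈ 𝔮`
  have h1u : (1 : A) - u ∈ 𝔮 := by rw [← neg_sub]; exact 𝔮.neg_mem hu1
  have ht' : (1 - u - b) * (u⁻¹ : Aˣ) ∈ 𝔮 := 𝔮.mul_mem_right _ (𝔮.sub_mem h1u hb)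
  have h2 : M.sym u b = M.sym u (1 - u) := by
    rw [← M.ms1_right hu1 hb hub ht']
    congr 1
    rw [mul_assoc, Units.inv_mul, mul_one]; ring
  -- `(u, 1 - u) ∼ (1, 1 - u) ∼ (1, 0)`
  have h3 : M.sym u (1 - u) = M.sym 1 (1 - u) := by
    rw [← M.ms1_left 1 hu1 h1u (isCoprime_unit_left u _)]; ring_nf
  rw [h1, h2, h3, M.sym_one_left h1u]

/-- **BMS Lemma 2.2 (b) / 2.7 (a), second case**: if `b = u + ta` with `u` a unit (`b ≡` unit
`mod aA`), then `[b over a] = 1`: with `q' = 1 - a ∈ 𝔮`,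
`(a, b) ∼ (a, bq') ∼ (a, uq') ∼ (1, uq') ∼ (1, 0)`. [cite: BassMilnorSerre1967, Ch. I Lemma 2.2 (b)] -/
theorem sym_eq_one_of_eq_unit_add {a b : A} (t : A) (u : Aˣ) (ha : a - 1 ∈ 𝔮) (hb : b ∈ 𝔮)
    (hab : IsCoprime a b) (h : b = u + t * a) : M.sym a b = 1 := by
  set q' : A := 1 - a with hq'
  have hq'mem : q' ∈ 𝔮 := by rw [hq', ← neg_sub]; exact 𝔮.neg_mem ha
  have haq' : IsCoprime a q' := ⟨1, 1, by rw [hq']; ring⟩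
  -- `(a, b) ∼ (a, b q')`
  have h1 : M.sym a b = M.sym a (b * q') := by
    rw [← M.ms1_right ha hb hab (𝔮.neg_mem hb), hq']; ring_nf
  have hbq' : b * q' ∈ 𝔮 := 𝔮.mul_mem_left _ hq'mem
  have habq' : IsCoprime a (b * q') := hab.mul_right haq'
  -- `(a, b q') ∼ (a, u q')`
  have h2 : M.sym a (b * q') = M.sym a (u * q') := by
    rw [← M.ms1_right ha hbq' habq' (𝔮.neg_mem (𝔮.mul_mem_left t hq'mem)), h]; ring_nf
  have huq' : (u : A) * q' ∈ 𝔮 := 𝔮.mul_mem_left _ hq'mem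
  have hauq' : IsCoprime a (u * q') := (isCoprime_unit_left u a).symm.mul_right haq'
  -- `(a, u q') ∼ (1, u q') ∼ (1, 0)`
  have h3 : M.sym a (u * q') = M.sym 1 (u * q') := by
    rw [← M.ms1_left ((u⁻¹ : Aˣ) : A) ha huq' hauq']
    congr 1
    rw [← mul_assoc, Units.inv_mul, one_mul, hq']; ring
  rw [h1, h2, h3, M.sym_one_left huq']

/-- `[b over a] = 1` for `a ≡ 1 (mod bA)` (`u = 1` in Lemma 2.7 (a)); in particular `[q over a] = 1`
for `a ≡ 1 (mod q)`. [cite: BassMilnorSerre1967, Ch. I Lemma 2.7 (a)] -/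
theorem sym_eq_one_of_sub_one_mem_span {a b : A} (ha : a - 1 ∈ 𝔮) (hb : b ∈ 𝔮)
    (h : a - 1 ∈ Ideal.span {b}) : M.sym a b = 1 := by
  obtain ⟨t, ht⟩ := Ideal.mem_span_singleton'.mp h
  have hab : IsCoprime a b := ⟨1, -t, by linear_combination -ht⟩
  exact M.sym_eq_one_of_eq_unit_sub (-t) 1 ha hb hab (by rw [Units.val_one]; linear_combination -ht)

end CommRing

/-! ### The principal case `𝔮 = (q)`: the map `b ↦ [bq over a]` (BMS (2.8)) -/

section Principal

variable {A : Type*} [CommRing A] {C : Type*} [Group C] {q : A}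
  (M : MennickeSymbol (Ideal.span {q}) C)

omit [Group C] in
/-- For `a ≡ 1 (mod q)` and `b` prime to `a`, the pair `(a, bq)` lies in `W_{(q)}`. [folklore] -/
theorem isCoprime_mul_q {a b : A} (ha : a - 1 ∈ Ideal.span {q}) (hab : IsCoprime a b) :
    IsCoprime a (b * q) := by
  obtain ⟨t, ht⟩ := Ideal.mem_span_singleton'.mp ha
  exact hab.mul_right ⟨1, -t, by linear_combination -ht⟩

/-- **BMS Lemma 2.7 (c)**: for `a ≡ 1 (mod q)`, `[bq over a]` only depends on `b` modulo `a`.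
[cite: BassMilnorSerre1967, Ch. I Lemma 2.7 (c)] -/
theorem sym_mul_q_eq_of_sub_mem {a b b' : A}
    (ha : a - 1 ∈ Ideal.span {q}) (hab : IsCoprime a b) (h : b' - b ∈ Ideal.span {a}) :
    M.sym a (b' * q) = M.sym a (b * q) := by
  obtain ⟨s, hs⟩ := Ideal.mem_span_singleton'.mp h
  have hbq : b * q ∈ Ideal.span {q} := Ideal.mul_mem_left _ _ (Ideal.mem_span_singleton_self q)
  rw [← M.ms1_right ha hbq (isCoprime_mul_q ha hab)
    (Ideal.mul_mem_left _ s (Ideal.mem_span_singleton_self q))]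
  congr 1
  linear_combination -q * hs

/-- **BMS Lemma 2.9 (a)**: for `a ≡ 1 (mod q)`, `b ↦ [bq over a]` is multiplicative on elements
prime to `a` (MS2 twice and `[q over a] = 1`). [cite: BassMilnorSerre1967, Ch. I Lemma 2.9 (a)] -/
theorem sym_mul_q_mul {a b₁ b₂ : A}
    (ha : a - 1 ∈ Ideal.span {q}) (h₁ : IsCoprime a b₁) (h₂ : IsCoprime a b₂) :
    M.sym a (b₁ * b₂ * q) = M.sym a (b₁ * q) * M.sym a (b₂ * q) := by
  have hq : q ∈ Ideal.span {q} := Ideal.mem_span_singleton_self q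
  have hmq : ∀ c : A, c * q ∈ Ideal.span {q} := fun c ↦ Ideal.mul_mem_left _ _ hq
  have haq : IsCoprime a q := by simpa using isCoprime_mul_q ha (isCoprime_one_right (x := a))
  have h12 : IsCoprime a (b₁ * b₂) := h₁.mul_right h₂
  have e1 : M.sym a (b₁ * q * (b₂ * q)) = M.sym a (b₁ * q) * M.sym a (b₂ * q) :=
    M.ms2 ha (hmq b₁) (hmq b₂) (isCoprime_mul_q ha h₁) (isCoprime_mul_q ha h₂)
  have e2 : M.sym a (b₁ * b₂ * q * q) = M.sym a (b₁ * b₂ * q) * M.sym a q :=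
    M.ms2 ha (hmq _) hq (isCoprime_mul_q ha h12) haq
  have e3 : M.sym a q = 1 := M.sym_eq_one_of_sub_one_mem_span ha hq ha
  rw [e3, mul_one] at e2
  rw [← e2, ← e1]
  congr 1; ring

/-- `[bq over a]ⁿ = [bⁿ q over a]` for `a ≡ 1 (mod q)`, `b` prime to `a`. [cite: BassMilnorSerre1967, Ch. I Lemma 2.9 (a)] -/
theorem sym_mul_q_pow {a b : A}
    (ha : a - 1 ∈ Ideal.span {q}) (hab : IsCoprime a b) (n : ℕ) :
    M.sym a (b * q) ^ n = M.sym a (b ^ n * q) := by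
  induction n with
  | zero =>
    rw [pow_zero, pow_zero, one_mul]
    exact (M.sym_eq_one_of_sub_one_mem_span ha (Ideal.mem_span_singleton_self q) ha).symm
  | succ n ih =>
    rw [pow_succ, ih, pow_succ, M.sym_mul_q_mul ha (hab.pow_right) hab]

/-- If `bⁿ ≡ 1 (mod a)` then `[bq over a]ⁿ = 1` (`a ≡ 1 (mod q)`): the symbol `[bq over a]` lies in a
homomorphic image of `U(A/aA)`. [cite: BassMilnorSerre1967, Ch. I Lemma 2.9 (a)] -/
theorem sym_mul_q_pow_eq_one {a b : A} {n : ℕ}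
    (ha : a - 1 ∈ Ideal.span {q}) (hab : IsCoprime a b) (h : b ^ n - 1 ∈ Ideal.span {a}) :
    M.sym a (b * q) ^ n = 1 := by
  rw [M.sym_mul_q_pow ha hab n, M.sym_mul_q_eq_of_sub_mem ha isCoprime_one_right h, one_mul]
  exact M.sym_eq_one_of_sub_one_mem_span ha (Ideal.mem_span_singleton_self q) ha

/-- The order of `[bq over a]` divides the order of `b` in `(A/aA)ˣ`: for `b` prime to `a` there is
`n` with `[bq over a]ⁿ = 1` and `n = ord(b mod a)`, namely `bⁿ ≡ 1 (mod a)`.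
[cite: BassMilnorSerre1967, Ch. I Thm. 3.6, proof, (ii)] -/
theorem exists_pow_eq_one_of_units {a b : A}
    (ha : a - 1 ∈ Ideal.span {q}) (hab : IsCoprime a b) :
    ∃ u : (A ⧸ Ideal.span {a})ˣ, (u : A ⧸ Ideal.span {a}) = Ideal.Quotient.mk _ b ∧
      M.sym a (b * q) ^ orderOf u = 1 := by
  obtain ⟨v, w, hvw⟩ := hab
  let u : (A ⧸ Ideal.span {a})ˣ := Units.mkOfMulEqOne (Ideal.Quotient.mk _ b) (Ideal.Quotient.mk _ w)
    (by
      rw [← map_mul, ← (Ideal.Quotient.mk (Ideal.span {a})).map_one, Ideal.Quotient.eq,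
        Ideal.mem_span_singleton']
      exact ⟨-v, by linear_combination -hvw⟩)
  refine ⟨u, rfl, M.sym_mul_q_pow_eq_one ha ⟨v, w, hvw⟩ ?_⟩
  rw [← Ideal.Quotient.eq, map_pow, map_one]
  have h1 : ((u : A ⧸ Ideal.span {a})) ^ orderOf u = 1 := by
    rw [← Units.val_pow_eq_pow_val, pow_orderOf_eq_one, Units.val_one]
  exact h1

end Principal

/-! ### Over `𝓞_K`, `K` with a real place: every symbol has order dividing `2` -/

section NumberField

variable {K : Type} [Field K] [NumberField K] {q : 𝓞 K} {C : Type*} [Group C]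
  (M : MennickeSymbol (Ideal.span {q}) C)

/-- **BMS Thm. 3.6, steps (i)–(ii), for a ring of integers with a real place** (`m = 2`): every
value `[b over a]`, `(a, b) ∈ W_{(q)}`, of a Mennicke symbol satisfies `[b over a]² = 1`.  For each
prime `l`, Serre's Lemme 3 / BMS Thm. 3.2 (`exists_add_mul_forall_not_dvd_orderOf`) moves `a` inside
its class modulo `b` to `a₁` with `U(A/a₁A)` free of elements of order divisible by
`l^{v_l(2)+1}`; as `[b over a] = [b over a₁]` has order dividing that of `b/q` in `U(A/a₁A)`, its
order has `l`-adic valuation `≤ v_l(2)` for every `l`, i.e. divides `2`.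
[cite: BassMilnorSerre1967, Ch. I Thm. 3.6 (ii)] -/
theorem sym_sq_eq_one (σ : K →+* ℝ) {a b : 𝓞 K} (ha : a - 1 ∈ Ideal.span {q})
    (hb : b ∈ Ideal.span {q}) (hab : IsCoprime a b) : M.sym a b ^ 2 = 1 := by
  classical
  -- write `b = b' q`
  obtain ⟨b', rfl⟩ := Ideal.mem_span_singleton'.mp hb
  by_cases hb0 : b' * q = 0
  · -- `b = 0`: then `a` is a unit and `[0 over a] = 1`
    rw [hb0] at hab ⊢
    have hau : IsUnit a := isCoprime_zero_right.mp hab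
    rw [M.sym_eq_one_of_eq_unit_add (-1) hau.unit ha (Ideal.zero_mem _) hab (by simp), one_pow]
  -- for every prime `l`, some power `n` with `v_l(n) ≤ v_l(2)` kills the symbol
  have key : ∀ l : ℕ, l.Prime → ∃ n : ℕ, 0 < n ∧ M.sym a (b' * q) ^ n = 1 ∧
      ¬ l ^ (padicValNat l 2 + 1) ∣ n := by
    intro l hl
    obtain ⟨t, ht0, ht⟩ := exists_add_mul_forall_not_dvd_orderOf σ hab hb0 hl
    set a₁ := a + t * (b' * q) with ha₁
    have ha₁q : a₁ - 1 ∈ Ideal.span {q} := by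
      have : a₁ - 1 = (a - 1) + t * b' * q := by rw [ha₁]; ring
      rw [this]
      exact Ideal.add_mem _ ha (Ideal.mul_mem_left _ _ (Ideal.mem_span_singleton_self q))
    have hab₁ : IsCoprime a₁ b' := by
      have : IsCoprime a₁ (b' * q) := by rw [ha₁]; exact hab.add_mul_right_left t
      exact this.of_mul_right_left
    have hsym : M.sym a (b' * q) = M.sym a₁ (b' * q) := (M.ms1_left t ha hb hab).symm
    haveI : Finite (𝓞 K ⧸ Ideal.span {a₁}) :=
      Ideal.finiteQuotientOfFreeOfNeBot _ (by rw [Ne, Ideal.span_singleton_eq_bot]; exact ht0)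
    obtain ⟨u, -, hu⟩ := M.exists_pow_eq_one_of_units ha₁q hab₁
    exact ⟨orderOf u, orderOf_pos u, by rw [hsym, hu], ht u⟩
  -- hence the order `d` of the symbol divides `2`
  set x := M.sym a (b' * q) with hx
  have hd : orderOf x ∣ 2 := by
    obtain ⟨n₂, hn₂, hx₂, -⟩ := key 2 Nat.prime_two
    have hdpos : 0 < orderOf x := orderOf_pos_iff.mpr (isOfFinOrder_iff_pow_eq_one.mpr ⟨n₂, hn₂, hx₂⟩)
    rw [← Nat.factorization_le_iff_dvd hdpos.ne' two_ne_zero]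
    intro l
    by_cases hl : l.Prime
    · obtain ⟨n, hn, hxn, hndvd⟩ := key l hl
      have h1 : (orderOf x).factorization l ≤ n.factorization l :=
        (Nat.factorization_le_iff_dvd hdpos.ne' hn.ne').mpr (orderOf_dvd_of_pow_eq_one hxn) l
      have h2 : n.factorization l < padicValNat l 2 + 1 := by
        rw [← not_le, ← hl.pow_dvd_iff_le_factorization hn.ne']
        exact hndvd
      rw [Nat.factorization_def 2 hl]
      omega
    · simp [Nat.factorization_eq_zero_of_not_prime _ hl]
  exact orderOf_dvd_iff_pow_eq_one.mp hd

end NumberField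

end MennickeSymbol

end SerreSL2

end Literature.NumberTheory.Automorphic
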